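import Literature.IUT.HodgeArakelov.ThetaEnvDataRecordAutSaturatedOfCor28iIntrinsicOfHgalois
import Literature.AnabelianGeometry.AbsoluteAnabelian.AbsTopIII.Cor110Natural

/-!
# [IUTchII] Prop 3.4 (i) at the GENUINE data — node IUTchII:Prop3.4(i), binder (P3) := the NAMED FACT `AbsTopIII.Cor_1_10_iii_natural`
# ([AbsTopIII] Cor 1.10 (iii) WITH ITS PRINTED FUNCTORIALITY, Galois side, tempered version; F-0396 / F-0348 retyped to printed strength,
# p465730) CONSUMED BY NAME — abc-iut C-R46 (c), companion 1/2

S. Mochizuki, *Inter-universal Teichmüller theory II*, kurims manuscript (Dec. 2020): Prop 3.4 (i) pp. 91–92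
[cite: Mochizuki2012, Prop 3.4 (i) p.91]; Cor 1.11 (b) p. 49; Prop 1.4 p. 27.  Claim key DISPUTED (D-0012).  Refereed inputs BY
NAME ([EtTh] = S. Mochizuki, Publ. RIMS **45** (2009)): Cor. 2.18 (i) p. 60 (F-0620 `RigidData.Cor218_i`), Prop. 2.4 p. 38 (F-0609
`TemperedCoverData.Prop24`), Cor. 2.8 (i) p. 42 (F-0640 `ThetaOrbitData.Cor28_i`) [cite: MochizukiEtTh2009, Cor 2.8(i) p.42], §1
pp. 12–13 (the class-R origin clauses `IsEtThOrigin`, `hYcl` = G-w4d021-2, `IsTateOrigin` — interface root data, never asserted);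
[AbsTopIII] = S. Mochizuki, *Topics in absolute anabelian geometry III*, Cor. 1.10 (iii) p. 43 l. 27–30 with its functoriality clause
p. 44 l. 33–34 (tempered version, Rmks. 1.9.1 / 1.9.2 / 1.10.2) [cite: MochizukiAbsTopIII2015, Cor 1.10 (iii) p.43] — now the NAMED FACT
`Literature.AnabelianGeometry.AbsoluteAnabelian.AbsTopIII.Cor_1_10_iii_natural` (statement-only, abc-iut-f-052 gen 5, p465730; cell
rulings C-R25 / C-R46 (a) / C-R50: FACT-LIST rows F-0396 `Cor_1_10_iii` / F-0348 `Cor_1_10_ii_c` retyped to printed strength,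
human-approved OPTION A, D-0067 exception): `Cor_1_10_iii_natural D := IsAlgebraic ℚ (tateJ D.qX) → ∀ H ≤ Π^tp_X open of finite
index, TemperedAutOverGQp D H`.  abc-iut cell, layer L6, row C-R46 (c) (abc-iut-plan g9 18:10:29Z; L6-lead §F v1.19bg/bh), seat
abc-iut-C-hgal-2 (gen 0); node-holder lineage abc-iut-w5-d169 (RQ7 reader named by L6-lead).

PROOF-ONLY RE-CUT (no definition, no `Prop`-valued fact, nothing restated).  The three ROUTE-2 statement-of-record consumers of
node IUTchII:Prop3.4(i) at (P3) := (HGAL) alone (abc-iut-w5-d169 gen 6, `ThetaEnvDataRecordAutSaturatedOfCor28iIntrinsicOfHgalois`,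
p456377) bind the anonymous hypothesis
`hHGAL : ∀ α : Π^tp_{X̲̲} ≃ₜ* Π^tp_{X̲̲}, ∃ τ ∈ G_{ℚ_p}, ∀ x, aug (α x) = τ · aug x · τ⁻¹` («every topological automorphism of
`Π^tp_{X̲̲}` lies over `Inn(τ)|_{G_K}`», the census-of-record residual (HGAL) of GAP-LEDGER G-w5d169-3, ruling C-R25).  HERE that
binder is SUPPLIED BY NAME: the fact `hgal : AbsTopIII.Cor_1_10_iii_natural D` under its printed hypothesis «`X` of strictly Belyi
type», which the fact renders on the interface as `IsAlgebraic ℚ (tateJ D.qX)` («`j(E_{q_X}) ∈ ℚ̄`») — displayed here as the class-R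
ORIGIN DATUM `hj` (dictionary / provenance clause (O) of C-R25: at the cone's data `X_v = (E_F ∖ {O}) ×_F K_v` one has
`j(E_{q_v}) = j(E_F) ∈ F`, [IUTchI] Def. 3.1 (b); [AbsTopIII] Rmk. 2.8.3) — applied to the open index-`l²` subgroup `Π^tp_{X̲̲} = C.Huu`
(`hHGAL_of_cor_1_10_iii_natural`; the fact's `TemperedAutOverGQp D C.Huu` IS the binder, reducibly); everything else is the landed
theorem verbatim:
* **`EtaleLevels.prop34i_multiradiallyDefined_saturated_ofCor28iIntrinsic_ofCor110iiiNatural`** (+ `exists_coeff_…`) — the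
  by-name-weakest statement of record (abc-iut-w6-d051's COMPANION-FREE form, p447525 / p456377).  Residual BY NAME exactly:
  F-0620 · F-0609 · F-0640 · **F-0396/F-0348 = `hgal : Cor_1_10_iii_natural D`** · `hj` (origin datum) · `hq` (R3) · `hO'` · `hYcl` ·
  `hT` · `hιe` · `hstd` · `hDtau'` · `hInd` · the standing record/tower inputs — NO anonymous anabelian hypothesis left.
* **`EtaleLevels.prop34i_multiradiallyDefined_saturated_ofCor28i_innerAdjust_ofCor110iiiNatural`** (+ `exists_coeff_…`) — ROUTE 2 v2
  (inner-adjusted `Dtau` clause, p444361 v2 / p456377).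
* **`EtaleLevels.prop34i_multiradiallyDefined_saturated_ofCor28iStableOfDelta_ofCor110iiiNatural`** (+ `exists_coeff_…`) — ROUTE 2
  stable-of-Δ (abc-iut-w6-d002, p451697 / p456377).
HONEST FRAMING: a re-cut consumes a named fact and discharges nothing; `Cor_1_10_iii_natural` is OUR typed statement of a refereed
result ([AbsTopIII], 2015), held statement-only and bound AT the instance (relative to the interface `ThetaSetting` its universal
closure is a schema, as the fact's own docstring says); nothing here asserts anything of [IUTchII], [EtTh] or [AbsTopIII]; no side
taken on [IUTchIII] Cor 3.12; typed ≠ proved.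
-/

noncomputable section

open Topology

namespace Literature.IUT.HodgeArakelov

open Literature.AnabelianGeometry.EtaleTheta Literature.AnabelianGeometry.SemiGraphs
open CohomologySystemOfContH1 EtaleThetaDataOfSetting TemperedThetaMonoids ThetaCovers
open scoped Literature.AnabelianGeometry.EtaleTheta

namespace EtaleLevels

universe u

variable {p : ℕ} [Fact p.Prime] {D : Literature.AnabelianGeometry.EtaleTheta.ThetaSetting p}
  {E : D.EtaleThetaData} {l : ℕ} (C : E.DoubleUnderline l) (hC : D.Compat) (hS : D.Sec2Hyps)
  (hl : l.Prime) (hp2 : p ≠ 2) (hpl : p ≠ l) (hζ : ∃ ζ : D.K, IsPrimitiveRoot ζ (4 * l))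
  (mods : ∀ M : ℕ+, D.CyclotomeMod l M)
  (f : contCocycles D.toTheta D.DeltaTheta C.GtpYdduu) (hf : f ∈ C.rootCocycles hC)
  (hmods : ∀ (M M' : ℕ+) (h : (M : ℕ) ∣ (M' : ℕ)) (x : D.lDeltaTheta l),
    MuN.red p M M' h ((mods M').red x) = (mods M).red x)
  (h15 : Literature.AnabelianGeometry.EtaleTheta.ThetaSetting.Prop15iii E hC) (L : C.CuspLabels)
  (hZ : ∀ M : ℕ+, Nonempty (ModelCyclotomes.lDeltaQuot (C.rigidData (mods M) hC hS h15 L) ≃*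
    Literature.IUT.HodgeTheaters.ZHat))
  (hlim : Function.Bijective (rigidLimHom C hC hS hl hp2 hpl hζ mods f hf hmods h15 L hZ))
  [(EtaleThetaDataOfSetting.PiYdd C).Normal]
  (hq : IsQuotientMap D.toTheta) {N : ℕ+} (μ : D.CyclotomeMod l N)
  (R : RigidData.{0} N l) (hR : R = C.rigidData μ hC hS h15 L) (h218i : R.Cor218_i)
  -- ROUTE 2 inputs along the orbit embedding `ε` (abc-iut-w5-d118 / abc-iut-w6-d051 / abc-iut-w6-d002 suppliers)
  {T : TemperedCoverData.{u} l} (ε : C.OrbitEmbedding T)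
  (hιe : IsOpenEmbedding ε.ι) (h24 : T.Prop24) (hstd : (ThetaOrbitData.ofEmbedding ε hC hS).IsStandard)
  (h28 : (ThetaOrbitData.ofEmbedding ε hC hS).Cor28_i)
  (hDtau' : ∀ Γ : T.Gtp ≃ₜ* T.Gtp, (∀ S ∈ T.tower, S.map Γ.toMulEquiv.toMonoidHom = S) →
    ∃ u ∈ C.Huu, ∀ Dt ∈ (ThetaOrbitData.ofEmbedding ε hC hS).Dtau,
      Dt.map (Γ.trans (ThetaOrbitData.innerAutTop (ε.ι u))).toMulEquiv.toMonoidHom ∈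
        (ThetaOrbitData.ofEmbedding ε hC hS).Dtau)
  -- companion-free: `hInd`
  (hInd : ∀ Γ : T.Gtp ≃ₜ* T.Gtp, (∀ S ∈ T.tower, S.map Γ.toMulEquiv.toMonoidHom = S) →
    ∃ ΓΘ : (ThetaOrbitData.ofEmbedding ε hC hS).DeltaTheta ≃* (ThetaOrbitData.ofEmbedding ε hC hS).DeltaTheta,
      (ThetaOrbitData.ofEmbedding ε hC hS).InducesOnTheta Γ ΓΘ)
  -- v2 / stable-of-Δ: `hιX` + `hΔ`
  (hιX : ε.ι.range = T.tp T.PiX)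
  (hΔ : ∀ γ : D.PiTemp ≃ₜ* D.PiTemp, D.DeltaTemp.map γ.toMulEquiv.toMonoidHom = D.DeltaTemp)
  -- index / constants / origin
  (ι₀ : (Pi C) ≃ₜ* (Pi C))
  {Es : Set ℕ+} (τw : D.CyclotomeTower l Es)
  (O : Submonoid (PadicAlgCl p)ˣ)
  (hO : ∀ (σ : GQp p) (u : (PadicAlgCl p)ˣ), u ∈ O → Units.map (σ : PadicAlgCl p →* PadicAlgCl p) u ∈ O)
  (hO' : D.IsEtThOrigin)
  -- the class-R §1 origin clauses under which (HCYC) ⟸ (HGAL) (`EtaleThetaDataOfSetting.hcyc_of_hgal`)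
  (hYcl : (D.DtpY.map D.toHat.toMonoidHom).topologicalClosure ≤
    D.DtpY.map D.toHat.toMonoidHom ⊔ (⁅⁅D.DeltaHat, D.DeltaHat⁆, D.DeltaHat⁆).topologicalClosure)
  (hT : D.IsTateOrigin)
  -- (P3) := THE NAMED FACT [AbsTopIII] Cor 1.10 (iii) with its printed functoriality, Galois side, tempered version (abc-iut-f-052,
  -- p465730; F-0396 / F-0348 retyped to printed strength) + its printed hypothesis «X of strictly Belyi type» rendered on the
  -- interface as the class-R ORIGIN DATUM `hj` : `j(E_{q_X})` is algebraic over `ℚ` (provenance clause (O) of C-R25: at the cone's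
  -- data `j(E_{q_v}) = j(E_F) ∈ F`, [IUTchI] Def. 3.1 (b); [AbsTopIII] Rmk. 2.8.3)
  (hj : IsAlgebraic ℚ (Literature.NumberTheory.EllipticCurves.tateJ D.qX))
  (hgal : Literature.AnabelianGeometry.AbsoluteAnabelian.AbsTopIII.Cor_1_10_iii_natural D)

/-! ### The (HGAL) clause of the fact -/

omit [(EtaleThetaDataOfSetting.PiYdd C).Normal] in
include hj hgal in
/-- **The named fact at the instance `H := Π^tp_{X̲̲}`** — the (HGAL) binder of the `…_ofHgalois` statements of record, VERBATIM:
[AbsTopIII] Cor. 1.10 (iii) with its printed functoriality (`AbsTopIII.Cor_1_10_iii_natural D`, abc-iut-f-052 p465730), under its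
printed hypothesis «strictly Belyi type» (`hj` : `j(E_{q_X}) ∈ ℚ̄`), applied to the open subgroup of finite index
`Π^tp_{X̲̲} = C.Huu ≤ Π^tp_X` (abc-iut-L2-t8's `isOpen_Huu`, index `l²`): every topological automorphism of `Π^tp_{X̲̲}` lies over
`Inn(τ)|_{G_K}` for some `τ ∈ G_{ℚ_p}` (`AbsTopIII.TemperedAutOverGQp D C.Huu`, reducibly the consumers' binder over
`Pi C = TopGroup.mk ↥C.Huu`, `aug C = aug ∘ C.Huu.subtype`). [cite: MochizukiAbsTopIII2015, Cor 1.10 (iii) p.43] -/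
theorem hHGAL_of_cor_1_10_iii_natural :
    ∀ α : (Pi C) ≃ₜ* (Pi C), ∃ τ : GQp p, ∀ x : Pi C, aug C (α x) = τ * aug C x * τ⁻¹ :=
  hgal hj C.Huu C.isOpen_Huu ⟨by rw [C.index_Huu]; exact pow_ne_zero 2 C.l_ne_zero⟩

/-! ### Route 2, companion-free (`hInd`): (P3) := the fact -/

/-- **[IUTchII] Prop 3.4 (i) — MULTIRADIALITY OF SPLIT THETA MONOIDS AT THE GENUINE FUNCTOR, Route 2 companion-free,
(P3) := the FACT `Cor_1_10_iii_natural` BY NAME**: (P1) := {F-0620, `hq`} (`hcharY` derived from F-0620); (P2) none (saturated index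
set); (P3) := `hgal : AbsTopIII.Cor_1_10_iii_natural …` (F-0348 / F-0396, [AbsTopIII] Cor 1.10 (c) at printed strength) + class-R clauses `hYcl`,
`hT` — the cyclotomic half (HCYC) PROVED (`hcyc_of_hgal`); (P4) := abc-iut-w6-d051's
`rootHyp_of_cor28_i_intrinsic_innerAdjust` (F-0609 `h24`, F-0640 `h28`, `hstd`, `hDtau'`, `hInd`, `hιe`).
[cite: Mochizuki2012, Prop 3.4 (i) p.92] -/
theorem prop34i_multiradiallyDefined_saturated_ofCor28iIntrinsic_ofCor110iiiNatural
    (c : CyclotomeCoefficients (phi C) (D.lDeltaTheta l) (PadicAlgCl p)ˣ)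
    (hlev : ∀ (ζ : cyclotome (PadicAlgCl p)ˣ) (M : ℕ+),
      (((τw.modAll M).red (c.hom ζ) : MuN p M) : (PadicAlgCl p)ˣ) = (ζ : ℕ+ → (PadicAlgCl p)ˣ) M)
    {η : (C.thetaEnvData μ hC hS).PiYdd → MuN p N} (hη : η ∈ (C.thetaEnvData μ hC hS).thetaCocycles)
    (Γ : Type) [Group Γ] :
    haveI := hC.GtpYdd_normal
    ((ex18iii (ThetaSetting.ofDoubleUnderline C μ hC hS hl hp2 hpl hζ hη) Γ).toDagger
      (TemperedThetaMonoids.prop34iRadialFunctor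
        (thetaEnvTransportS C hC hS hl hp2 hpl hζ mods f hf hmods h15 L hZ
          (piYddCharacteristic_of_cor218_i C μ hC hS h15 L R hR h218i) hlim hq μ R hR h218i
          (h1LimKummerOn (phi C) (D.lDeltaTheta l) (PiYdd C) c (isOpen_stabilizer_units C)
            (finiteIndex_stabilizer_units C) O) ι₀
          (map_mrange_h1LimKummerOn_eq_of_galois C hq μ τw c hlev O hO hC hS h15 L R hR h218i hO'
            (hgal_of_hgalois C hO' hYcl hT hS hq μ hC h15 L R hR h218i τw
      (hHGAL_of_cor_1_10_iii_natural C hj hgal)))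
          (image_toLim_theta_thetaEnvData_of_rootHyp C hC hS hl hp2 hpl hζ mods f hf hmods h15 L hZ
            (piYddCharacteristic_of_cor218_i C μ hC hS h15 L R hR h218i) hlim hq μ R hR h218i
            (fun α => rootHyp_of_cor28_i_intrinsic_innerAdjust C hq α ε μ hC hS h15 L R hR h218i hιe h24 hstd h28
              hDtau' hInd))
          (image_thetaInfty_thetaEnvData_of_rootHyp C hC hS hl hp2 hpl hζ mods f hf hmods h15 L hZ
            (piYddCharacteristic_of_cor218_i C μ hC hS h15 L R hR h218i) hlim hq μ R hR h218i
            (fun α => rootHyp_of_cor28_i_intrinsic_innerAdjust C hq α ε μ hC hS h15 L R hR h218i hιe h24 hstd h28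
              hDtau' hInd)) hη)
        Γ)).IsMultiradiallyDefined := by
  haveI := hC.GtpYdd_normal
  exact prop34i_multiradiallyDefined_saturated_ofCor28iIntrinsic_ofHgalois C hC hS hl hp2 hpl hζ mods f hf hmods h15 L hZ
    hlim hq μ R hR h218i ε hιe h24 hstd h28 hDtau' hInd ι₀ τw O hO hO' hYcl hT (hHGAL_of_cor_1_10_iii_natural C hj hgal) c hlev hη Γ

/-- **The same with the coefficient datum DISCHARGED** (`exists_cyclotomeCoefficients_of_cyclotomeTower` under `hO'` + `hΔc`):
residual BY NAME {F-0620, F-0609, F-0640, F-0396/F-0348 (`hgal` : `AbsTopIII.Cor_1_10_iii_natural D`, + origin datum `hj`), `hq`, `hO'`, `hYcl`, `hT`, `hΔc`, `hιe`, `hstd`, `hDtau'`, `hInd`}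
plus the standing record/tower inputs (no `hcharY`, no `hιX`, no `hΔ`, no theta companion, no (HCYC), no anonymous anabelian hypothesis). [cite: Mochizuki2012, Prop 3.4 (i) p.92] -/
theorem exists_coeff_prop34i_multiradiallyDefined_saturated_ofCor28iIntrinsic_ofCor110iiiNatural
    (hΔc : IsCompact (D.DeltaTheta : Set D.GtpTheta))
    {η : (C.thetaEnvData μ hC hS).PiYdd → MuN p N} (hη : η ∈ (C.thetaEnvData μ hC hS).thetaCocycles)
    (Γ : Type) [Group Γ] :
    haveI := hC.GtpYdd_normal
    ∃ (c : CyclotomeCoefficients (phi C) (D.lDeltaTheta l) (PadicAlgCl p)ˣ)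
      (hlev : ∀ (ζ : cyclotome (PadicAlgCl p)ˣ) (M : ℕ+),
        (((τw.modAll M).red (c.hom ζ) : MuN p M) : (PadicAlgCl p)ˣ) = (ζ : ℕ+ → (PadicAlgCl p)ˣ) M),
      Function.Bijective c.hom ∧
      ((ex18iii (ThetaSetting.ofDoubleUnderline C μ hC hS hl hp2 hpl hζ hη) Γ).toDagger
        (TemperedThetaMonoids.prop34iRadialFunctor
          (thetaEnvTransportS C hC hS hl hp2 hpl hζ mods f hf hmods h15 L hZ
            (piYddCharacteristic_of_cor218_i C μ hC hS h15 L R hR h218i) hlim hq μ R hR h218i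
            (h1LimKummerOn (phi C) (D.lDeltaTheta l) (PiYdd C) c (isOpen_stabilizer_units C)
              (finiteIndex_stabilizer_units C) O) ι₀
            (map_mrange_h1LimKummerOn_eq_of_galois C hq μ τw c hlev O hO hC hS h15 L R hR h218i hO'
              (hgal_of_hgalois C hO' hYcl hT hS hq μ hC h15 L R hR h218i τw
      (hHGAL_of_cor_1_10_iii_natural C hj hgal)))
            (image_toLim_theta_thetaEnvData_of_rootHyp C hC hS hl hp2 hpl hζ mods f hf hmods h15 L hZ
              (piYddCharacteristic_of_cor218_i C μ hC hS h15 L R hR h218i) hlim hq μ R hR h218i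
              (fun α => rootHyp_of_cor28_i_intrinsic_innerAdjust C hq α ε μ hC hS h15 L R hR h218i hιe h24 hstd h28
                hDtau' hInd))
            (image_thetaInfty_thetaEnvData_of_rootHyp C hC hS hl hp2 hpl hζ mods f hf hmods h15 L hZ
              (piYddCharacteristic_of_cor218_i C μ hC hS h15 L R hR h218i) hlim hq μ R hR h218i
              (fun α => rootHyp_of_cor28_i_intrinsic_innerAdjust C hq α ε μ hC hS h15 L R hR h218i hιe h24 hstd h28
                hDtau' hInd)) hη)
          Γ)).IsMultiradiallyDefined := by
  haveI := hC.GtpYdd_normal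
  exact exists_coeff_prop34i_multiradiallyDefined_saturated_ofCor28iIntrinsic_ofHgalois C hC hS hl hp2 hpl hζ mods f hf
    hmods h15 L hZ hlim hq μ R hR h218i ε hιe h24 hstd h28 hDtau' hInd ι₀ τw O hO hO' hYcl hT (hHGAL_of_cor_1_10_iii_natural C hj hgal) hΔc hη Γ

/-! ### Route 2, v2 inner-adjusted (`hιX`, `hΔ`, `hDtau'`): `hcharY` from F-0620; (P3) := the fact -/

/-- **[IUTchII] Prop 3.4 (i) — MULTIRADIALITY OF SPLIT THETA MONOIDS AT THE GENUINE FUNCTOR, Route 2 v2 (inner-adjusted `Dtau`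
clause), (P3) := the FACT BY NAME**: abc-iut-w5-d169's `prop34i_multiradiallyDefined_saturated_ofCor28i_innerAdjust_ofHgalois` (p456377)
with `hHGAL := hHGAL_of_cor_1_10_iii_natural C hgal` (`hcharY` from F-0620, (HCYC) from `hcyc_of_hgal`); (P4) := abc-iut-w5-d118's
`rootHyp_of_cor28_i_innerAdjust` (F-0609 `h24`, F-0640 `h28`, `hstd`, `hDtau'`, `hιe`, `hιX`, `hΔ`).
[cite: Mochizuki2012, Prop 3.4 (i) p.92] -/
theorem prop34i_multiradiallyDefined_saturated_ofCor28i_innerAdjust_ofCor110iiiNatural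
    (c : CyclotomeCoefficients (phi C) (D.lDeltaTheta l) (PadicAlgCl p)ˣ)
    (hlev : ∀ (ζ : cyclotome (PadicAlgCl p)ˣ) (M : ℕ+),
      (((τw.modAll M).red (c.hom ζ) : MuN p M) : (PadicAlgCl p)ˣ) = (ζ : ℕ+ → (PadicAlgCl p)ˣ) M)
    {η : (C.thetaEnvData μ hC hS).PiYdd → MuN p N} (hη : η ∈ (C.thetaEnvData μ hC hS).thetaCocycles)
    (Γ : Type) [Group Γ] :
    haveI := hC.GtpYdd_normal
    ((ex18iii (ThetaSetting.ofDoubleUnderline C μ hC hS hl hp2 hpl hζ hη) Γ).toDagger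
      (TemperedThetaMonoids.prop34iRadialFunctor
        (thetaEnvTransportS C hC hS hl hp2 hpl hζ mods f hf hmods h15 L hZ
          (piYddCharacteristic_of_cor218_i C μ hC hS h15 L R hR h218i) hlim hq μ R hR h218i
          (h1LimKummerOn (phi C) (D.lDeltaTheta l) (PiYdd C) c (isOpen_stabilizer_units C)
            (finiteIndex_stabilizer_units C) O) ι₀
          (map_mrange_h1LimKummerOn_eq_of_galois C hq μ τw c hlev O hO hC hS h15 L R hR h218i hO'
            (hgal_of_hgalois C hO' hYcl hT hS hq μ hC h15 L R hR h218i τw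
      (hHGAL_of_cor_1_10_iii_natural C hj hgal)))
          (image_toLim_theta_thetaEnvData_of_rootHyp C hC hS hl hp2 hpl hζ mods f hf hmods h15 L hZ
            (piYddCharacteristic_of_cor218_i C μ hC hS h15 L R hR h218i) hlim hq μ R hR h218i
            (rootHyp_of_cor28_i_innerAdjust C ε hq μ hC hS h15 L R hR h218i hιe hιX hΔ h24 hstd h28 hDtau'))
          (image_thetaInfty_thetaEnvData_of_rootHyp C hC hS hl hp2 hpl hζ mods f hf hmods h15 L hZ
            (piYddCharacteristic_of_cor218_i C μ hC hS h15 L R hR h218i) hlim hq μ R hR h218i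
            (rootHyp_of_cor28_i_innerAdjust C ε hq μ hC hS h15 L R hR h218i hιe hιX hΔ h24 hstd h28 hDtau')) hη)
        Γ)).IsMultiradiallyDefined := by
  haveI := hC.GtpYdd_normal
  exact prop34i_multiradiallyDefined_saturated_ofCor28i_innerAdjust_ofHgalois C hC hS hl hp2 hpl hζ mods f hf hmods h15 L
    hZ hlim hq μ R hR h218i ε hιe h24 hstd h28 hDtau' hιX hΔ ι₀ τw O hO hO' hYcl hT (hHGAL_of_cor_1_10_iii_natural C hj hgal) c hlev hη Γ

/-- **The same with the coefficient datum DISCHARGED** (`exists_cyclotomeCoefficients_of_cyclotomeTower` under `hO'` + `hΔc`):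
residual BY NAME {F-0620, F-0609, F-0640, F-0396/F-0348 (`hgal` : `AbsTopIII.Cor_1_10_iii_natural D`, + origin datum `hj`), `hq`, `hO'`, `hYcl`, `hT`, `hΔc`, `hιe`, `hιX`, `hΔ`, `hstd`, `hDtau'`}
plus the standing record/tower inputs (no `hcharY`, no (HCYC)). [cite: Mochizuki2012, Prop 3.4 (i) p.92] -/
theorem exists_coeff_prop34i_multiradiallyDefined_saturated_ofCor28i_innerAdjust_ofCor110iiiNatural
    (hΔc : IsCompact (D.DeltaTheta : Set D.GtpTheta))
    {η : (C.thetaEnvData μ hC hS).PiYdd → MuN p N} (hη : η ∈ (C.thetaEnvData μ hC hS).thetaCocycles)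
    (Γ : Type) [Group Γ] :
    haveI := hC.GtpYdd_normal
    ∃ (c : CyclotomeCoefficients (phi C) (D.lDeltaTheta l) (PadicAlgCl p)ˣ)
      (hlev : ∀ (ζ : cyclotome (PadicAlgCl p)ˣ) (M : ℕ+),
        (((τw.modAll M).red (c.hom ζ) : MuN p M) : (PadicAlgCl p)ˣ) = (ζ : ℕ+ → (PadicAlgCl p)ˣ) M),
      Function.Bijective c.hom ∧
      ((ex18iii (ThetaSetting.ofDoubleUnderline C μ hC hS hl hp2 hpl hζ hη) Γ).toDagger
        (TemperedThetaMonoids.prop34iRadialFunctor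
          (thetaEnvTransportS C hC hS hl hp2 hpl hζ mods f hf hmods h15 L hZ
            (piYddCharacteristic_of_cor218_i C μ hC hS h15 L R hR h218i) hlim hq μ R hR h218i
            (h1LimKummerOn (phi C) (D.lDeltaTheta l) (PiYdd C) c (isOpen_stabilizer_units C)
              (finiteIndex_stabilizer_units C) O) ι₀
            (map_mrange_h1LimKummerOn_eq_of_galois C hq μ τw c hlev O hO hC hS h15 L R hR h218i hO'
              (hgal_of_hgalois C hO' hYcl hT hS hq μ hC h15 L R hR h218i τw
      (hHGAL_of_cor_1_10_iii_natural C hj hgal)))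
            (image_toLim_theta_thetaEnvData_of_rootHyp C hC hS hl hp2 hpl hζ mods f hf hmods h15 L hZ
              (piYddCharacteristic_of_cor218_i C μ hC hS h15 L R hR h218i) hlim hq μ R hR h218i
              (rootHyp_of_cor28_i_innerAdjust C ε hq μ hC hS h15 L R hR h218i hιe hιX hΔ h24 hstd h28 hDtau'))
            (image_thetaInfty_thetaEnvData_of_rootHyp C hC hS hl hp2 hpl hζ mods f hf hmods h15 L hZ
              (piYddCharacteristic_of_cor218_i C μ hC hS h15 L R hR h218i) hlim hq μ R hR h218i
              (rootHyp_of_cor28_i_innerAdjust C ε hq μ hC hS h15 L R hR h218i hιe hιX hΔ h24 hstd h28 hDtau')) hη)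
          Γ)).IsMultiradiallyDefined := by
  haveI := hC.GtpYdd_normal
  exact exists_coeff_prop34i_multiradiallyDefined_saturated_ofCor28i_innerAdjust_ofHgalois C hC hS hl hp2 hpl hζ mods f hf
    hmods h15 L hZ hlim hq μ R hR h218i ε hιe h24 hstd h28 hDtau' hιX hΔ ι₀ τw O hO hO' hYcl hT (hHGAL_of_cor_1_10_iii_natural C hj hgal) hΔc hη Γ

/-! ### Route 2, stable-of-Δ (`hInd` from `hιX` + `hΔ`): (P3) := the fact -/

/-- **[IUTchII] Prop 3.4 (i) — MULTIRADIALITY OF SPLIT THETA MONOIDS AT THE GENUINE FUNCTOR, Route 2 stable-of-Δ, (P3) = (HGAL)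
alone := the FACT BY NAME**: abc-iut-w6-d002's `prop34i_multiradiallyDefined_saturated_ofCor28iStableOfDelta` (p451697: the
companion-free statement with `hInd` DISCHARGED from `hιX` + `hΔ`) through its `_ofHgalois` form (p456377) with
`hHGAL := hHGAL_of_cor_1_10_iii_natural C hgal`. [cite: Mochizuki2012, Prop 3.4 (i) p.92] -/
theorem prop34i_multiradiallyDefined_saturated_ofCor28iStableOfDelta_ofCor110iiiNatural
    (c : CyclotomeCoefficients (phi C) (D.lDeltaTheta l) (PadicAlgCl p)ˣ)
    (hlev : ∀ (ζ : cyclotome (PadicAlgCl p)ˣ) (M : ℕ+),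
      (((τw.modAll M).red (c.hom ζ) : MuN p M) : (PadicAlgCl p)ˣ) = (ζ : ℕ+ → (PadicAlgCl p)ˣ) M)
    {η : (C.thetaEnvData μ hC hS).PiYdd → MuN p N} (hη : η ∈ (C.thetaEnvData μ hC hS).thetaCocycles)
    (Γ : Type) [Group Γ] :
    haveI := hC.GtpYdd_normal
    ((ex18iii (ThetaSetting.ofDoubleUnderline C μ hC hS hl hp2 hpl hζ hη) Γ).toDagger
      (TemperedThetaMonoids.prop34iRadialFunctor
        (thetaEnvTransportS C hC hS hl hp2 hpl hζ mods f hf hmods h15 L hZ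
          (piYddCharacteristic_of_cor218_i C μ hC hS h15 L R hR h218i) hlim hq μ R hR h218i
          (h1LimKummerOn (phi C) (D.lDeltaTheta l) (PiYdd C) c (isOpen_stabilizer_units C)
            (finiteIndex_stabilizer_units C) O) ι₀
          (map_mrange_h1LimKummerOn_eq_of_galois C hq μ τw c hlev O hO hC hS h15 L R hR h218i hO'
            (hgal_of_hgalois C hO' hYcl hT hS hq μ hC h15 L R hR h218i τw
      (hHGAL_of_cor_1_10_iii_natural C hj hgal)))
          (image_toLim_theta_thetaEnvData_of_rootHyp C hC hS hl hp2 hpl hζ mods f hf hmods h15 L hZ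
            (piYddCharacteristic_of_cor218_i C μ hC hS h15 L R hR h218i) hlim hq μ R hR h218i
            (fun α => rootHyp_of_cor28_i_innerAdjust_of_deltaPreserving C hq α ε μ hC hS h15 L R hR h218i hιe hιX hΔ
              h24 hstd h28 hDtau'))
          (image_thetaInfty_thetaEnvData_of_rootHyp C hC hS hl hp2 hpl hζ mods f hf hmods h15 L hZ
            (piYddCharacteristic_of_cor218_i C μ hC hS h15 L R hR h218i) hlim hq μ R hR h218i
            (fun α => rootHyp_of_cor28_i_innerAdjust_of_deltaPreserving C hq α ε μ hC hS h15 L R hR h218i hιe hιX hΔ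
              h24 hstd h28 hDtau')) hη)
        Γ)).IsMultiradiallyDefined := by
  haveI := hC.GtpYdd_normal
  exact prop34i_multiradiallyDefined_saturated_ofCor28iStableOfDelta_ofHgalois C hC hS hl hp2 hpl hζ mods f hf hmods h15 L
    hZ hlim hq μ R hR h218i ε hιe h24 hstd h28 hDtau' hιX hΔ ι₀ τw O hO hO' hYcl hT (hHGAL_of_cor_1_10_iii_natural C hj hgal) c hlev hη Γ

/-- **The same with the coefficient datum DISCHARGED** (`exists_cyclotomeCoefficients_of_cyclotomeTower` under `hO'` + `hΔc`):
residual BY NAME {F-0620, F-0609, F-0640, F-0396/F-0348 (`hgal` : `AbsTopIII.Cor_1_10_iii_natural D`, + origin datum `hj`), `hq`, `hO'`, `hYcl`, `hT`, `hΔc`, `hιe`, `hιX`, `hΔ`, `hstd`, `hDtau'`}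
plus the standing record/tower inputs. [cite: Mochizuki2012, Prop 3.4 (i) p.92] -/
theorem exists_coeff_prop34i_multiradiallyDefined_saturated_ofCor28iStableOfDelta_ofCor110iiiNatural
    (hΔc : IsCompact (D.DeltaTheta : Set D.GtpTheta))
    {η : (C.thetaEnvData μ hC hS).PiYdd → MuN p N} (hη : η ∈ (C.thetaEnvData μ hC hS).thetaCocycles)
    (Γ : Type) [Group Γ] :
    haveI := hC.GtpYdd_normal
    ∃ (c : CyclotomeCoefficients (phi C) (D.lDeltaTheta l) (PadicAlgCl p)ˣ)
      (hlev : ∀ (ζ : cyclotome (PadicAlgCl p)ˣ) (M : ℕ+),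
        (((τw.modAll M).red (c.hom ζ) : MuN p M) : (PadicAlgCl p)ˣ) = (ζ : ℕ+ → (PadicAlgCl p)ˣ) M),
      Function.Bijective c.hom ∧
      ((ex18iii (ThetaSetting.ofDoubleUnderline C μ hC hS hl hp2 hpl hζ hη) Γ).toDagger
        (TemperedThetaMonoids.prop34iRadialFunctor
          (thetaEnvTransportS C hC hS hl hp2 hpl hζ mods f hf hmods h15 L hZ
            (piYddCharacteristic_of_cor218_i C μ hC hS h15 L R hR h218i) hlim hq μ R hR h218i
            (h1LimKummerOn (phi C) (D.lDeltaTheta l) (PiYdd C) c (isOpen_stabilizer_units C)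
              (finiteIndex_stabilizer_units C) O) ι₀
            (map_mrange_h1LimKummerOn_eq_of_galois C hq μ τw c hlev O hO hC hS h15 L R hR h218i hO'
              (hgal_of_hgalois C hO' hYcl hT hS hq μ hC h15 L R hR h218i τw
      (hHGAL_of_cor_1_10_iii_natural C hj hgal)))
            (image_toLim_theta_thetaEnvData_of_rootHyp C hC hS hl hp2 hpl hζ mods f hf hmods h15 L hZ
              (piYddCharacteristic_of_cor218_i C μ hC hS h15 L R hR h218i) hlim hq μ R hR h218i
              (fun α => rootHyp_of_cor28_i_innerAdjust_of_deltaPreserving C hq α ε μ hC hS h15 L R hR h218i hιe hιX hΔ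
                h24 hstd h28 hDtau'))
            (image_thetaInfty_thetaEnvData_of_rootHyp C hC hS hl hp2 hpl hζ mods f hf hmods h15 L hZ
              (piYddCharacteristic_of_cor218_i C μ hC hS h15 L R hR h218i) hlim hq μ R hR h218i
              (fun α => rootHyp_of_cor28_i_innerAdjust_of_deltaPreserving C hq α ε μ hC hS h15 L R hR h218i hιe hιX hΔ
                h24 hstd h28 hDtau')) hη)
          Γ)).IsMultiradiallyDefined := by
  haveI := hC.GtpYdd_normal
  exact exists_coeff_prop34i_multiradiallyDefined_saturated_ofCor28iStableOfDelta_ofHgalois C hC hS hl hp2 hpl hζ mods f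
    hf hmods h15 L hZ hlim hq μ R hR h218i ε hιe h24 hstd h28 hDtau' hιX hΔ ι₀ τw O hO hO' hYcl hT (hHGAL_of_cor_1_10_iii_natural C hj hgal) hΔc hη Γ

end EtaleLevels

end Literature.IUT.HodgeArakelov

end
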